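import Literature.Computability.AlgebraicComplexity.ExactVP0Calculus
import Literature.Computability.AlgebraicComplexity.BurgisserThm210Proofs
import HarnessLib

/-!
# Bürgisser 2009, Thm. 2.10 for the PRINTED `VNP⁰`: the permanent projection with the printed
# entries `2y`, `y ∈ X ∪ {-1, -½, 0, ½, 1}` (`Burgisser2009_perProjection_exact`)

Companion of `BurgisserThm210Proofs.lean` (discharge of the tree's named fact
`ConstantFreeCompleteness.Burgisser2009_perProjection`: every family of the tree's class
`IsVNP0Family` is `2^{-p(n)} per(B_n)` with entries "`2 X_v` or an integer constant of
`τ`-complexity `≤ p(n)`" — a DISCLOSED ADAPTATION of the printed entry set, forced because the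
tree's `VP⁰` (fan-in AT MOST two) gives the empty gates `Σ ∅`, `Π ∅` formal degree `0` and so
contains families like `3^{2^n} X_1`; registry finding B41) and of `ExactVP0Calculus.lean` (the
PRINTED classes `IsExactVP0Family` / `IsExactVNP0Family`: fan-in EXACTLY two, Bürgisser, *On
defining integers …*, Def. 2.7–2.8 = BIJL 2018 Def. 29). For the printed class the printed
statement holds WORD FOR WORD (ECCC TR06-113, proof of Thm. 2.10, p. 8): "any family `(f_n)` in
`VNP⁰` can be expressed as a projection `f_n = Per_{p(n)}(y_1, …, y_{p(n)²})`, where `p(n)` is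
polynomially bounded in `n` and the `y_i` are either variables or constants taken from
`{-1, -1/2, 0, 1/2, 1}`. By homogeneity of the permanent we get
`2^{p(n)} f_n = Per_{p(n)}(2y_1, …, 2y_{p(n)²})`."

The one new input: in a circuit all of whose gates have at least one operand, EVERY gate has
formal degree `≥ 1` (`ArithCircuit.forall_one_le_gateFormalDegrees`; leaves have formal degree
`1`, sum = max, product = sum). Hence the collapse branch of `VP0Normal.lean` (a reference to a
gate of formal degree `0` becomes the leaf `C (cval j)`, the only source of the cheap constants)
is dead, and the parameters of the normalized circuit are `0, 1, -1, X v` only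
(`ArithCircuit.LeafParam`, `paramIn_kindC_leaf`). The rest is the landed completeness proof,
unchanged: `FactorSystem.exists_permanent` is generic in the parameter predicate, so the factor
system of `TokenCircuits.lean` has a permanent form with entries `0, ±1, X v`
(`exists_permanent_boolSum_leaf`, same size bound `cfBound`), and scaling by `2` plus padding with
ones and twos (`exists_printedPerProjection_matrix`) gives entries in `{2 X_v} ∪ {-2, …, 2}`
(`IsPrintedPerProjectionEntry`).

* `ArithCircuit.Operand.one_le_formalDegree`, `Gate.one_le_formalDegree`,
  `forall_one_le_gateFormalDegrees`, `one_le_getD_gateFormalDegrees`, `one_le_formalDegree`;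
* `ArithCircuit.LeafParam` (+ `.goodParam`, `leafParam_C_of_isSignConstant`),
  `paramIn_opKind_leaf`, `paramIn_kindC_leaf`, `exists_permanent_boolSum_leaf`;
* `IsPrintedPerProjectionEntry` (+ `.isPerProjectionEntry`: printed ⇒ the tree's entry predicate
  for `q ≥ 2`), `isPrintedPerProjectionEntry_two_mul/_ite`, `exists_printedPerProjection_matrix`;
* **`Burgisser2009_perProjection_exact`** — the displayed statement for `IsExactVNP0Family`
  with printed entries; `Burgisser2009_perProjection_of_exact` (the tree's form for printed
  families, via `IsExactVNP0Family.isVNP0Family`).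

HONEST FRAMING: typed-literature bookkeeping for a 2009 completeness statement; `VP ≠ VNP` is NOT
proved and nothing here bears on it. Two bookkeeping predicates (with bodies), no facts.

## References

* P. Bürgisser, *On defining integers and proving arithmetic circuit lower bounds*, Comput.
  Complexity 18 (2009) 81–103 = ECCC TR06-113, §2.2, Def. 2.7–2.8, Thm. 2.10 and its proof (p. 8)
  [Burgisser2006].
* P. Koiran, *Valiant's model and the cost of computing integers*, Comput. Complexity 13 (2004)
  131–146, Thm. 4.3 [Koiran2004].
* G. Malod, N. Portier, *Characterizing Valiant's algebraic complexity classes*, J. Complexity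
  24 (2008) 16–38, Thm. 2, Lemma 2 [MalodPortier2008].
* P. Bürgisser, *Completeness and Reduction in Algebraic Complexity Theory*, Springer 2000,
  §1.4, Def. 2.1 [Burgisser2000].
-/

noncomputable section

open MvPolynomial

universe u v

namespace Literature.Computability.AlgebraicComplexity

open Finset Matrix

/-! ### No empty gates: every formal degree is at least one -/

namespace ArithCircuit

section FormalDegreeOne

variable {k : Type u} {σ : Type v}

/-- An operand has formal degree `≥ 1` as soon as all recorded gate degrees are `≥ 1` (leaves
have formal degree `1`, junk references the default `1`). [cite: Burgisser2006, §2.2] -/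
theorem Operand.one_le_formalDegree {degs : List ℕ} (h : ∀ d ∈ degs, 1 ≤ d) (o : Operand k σ) :
    1 ≤ o.formalDegree degs := by
  cases o with
  | var _ => exact le_rfl
  | const _ => exact le_rfl
  | gate j =>
    simp only [Operand.formalDegree]
    rw [List.getD_eq_getElem?_getD]
    cases hj : degs[j]? with
    | none => simp
    | some d => simpa using h d (List.mem_of_getElem? hj)

/-- A gate with at least one operand has formal degree `≥ 1` (sum = max, product = sum of
operand degrees `≥ 1`). [cite: Burgisser2006, §2.2] -/
theorem Gate.one_le_formalDegree {degs : List ℕ} (h : ∀ d ∈ degs, 1 ≤ d) {g : Gate k σ}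
    (h1 : 1 ≤ g.fanIn) : 1 ≤ g.formalDegree degs := by
  cases g with
  | sum args =>
    rcases args with _ | ⟨a, l⟩
    · simp [Gate.fanIn, Gate.args] at h1
    · simp only [Gate.formalDegree, List.map_cons, List.foldr_cons]
      exact (Operand.one_le_formalDegree h a.2).trans (le_max_left _ _)
  | prod args =>
    rcases args with _ | ⟨w, l⟩
    · simp [Gate.fanIn, Gate.args] at h1
    · simp only [Gate.formalDegree, List.map_cons, List.sum_cons]
      exact (Operand.one_le_formalDegree h w).trans (Nat.le_add_right _ _)

/-- **Without empty gates every gate has formal degree `≥ 1`** ("all nodes except the input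
nodes have fan-in 2 … input nodes have formal degree 1", so no node of Bürgisser's printed model
has formal degree `0`). [cite: Burgisser2006, §2.2] -/
theorem forall_one_le_gateFormalDegrees (gs : List (Gate k σ)) (h1 : ∀ g ∈ gs, 1 ≤ g.fanIn) :
    ∀ d ∈ gateFormalDegrees gs, 1 ≤ d := by
  induction gs using List.reverseRecOn with
  | nil => simp [gateFormalDegrees]
  | append_singleton gs g ih =>
    rw [gateFormalDegrees_append_singleton]
    intro d hd
    have ih' := ih fun g' hg' => h1 g' (List.mem_append_left _ hg')
    rcases List.mem_append.1 hd with hd | hd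
    · exact ih' d hd
    · rw [List.mem_singleton] at hd
      subst hd
      exact Gate.one_le_formalDegree ih' (h1 g (by simp))

/-- Pointwise form with the default `1`. [cite: Burgisser2006, §2.2] -/
theorem one_le_getD_gateFormalDegrees (gs : List (Gate k σ)) (h1 : ∀ g ∈ gs, 1 ≤ g.fanIn) (j : ℕ) :
    1 ≤ (gateFormalDegrees gs).getD j 1 := by
  rw [List.getD_eq_getElem?_getD]
  cases hj : (gateFormalDegrees gs)[j]? with
  | none => simp
  | some d => simpa using forall_one_le_gateFormalDegrees gs h1 d (List.mem_of_getElem? hj)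

/-- A circuit without empty gates has formal degree `≥ 1`. [cite: Burgisser2006, §2.2] -/
theorem one_le_formalDegree (P : ArithCircuit k σ) (h1 : ∀ g ∈ P.gates, 1 ≤ g.fanIn) :
    1 ≤ P.formalDegree :=
  Operand.one_le_formalDegree (forall_one_le_gateFormalDegrees P.gates h1) P.output

end FormalDegreeOne

/-! ### The parameters of the normalized circuit of a circuit WITHOUT empty gates -/

variable {S : Type} {u : ℕ}

/-- **The printed parameters**: `0`, `1`, `-1` or a variable (Valiant's construction as inspected
by Bürgisser: "the `y_i` are either variables or constants"; before the scaling by `2`).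
Compare `GoodParam s` (adds constants of `τ ≤ s`, forced by the empty gates of the tree's `VP⁰`).
[cite: Burgisser2006, proof of Thm. 2.10] -/
def LeafParam (x : MvPolynomial S ℤ) : Prop :=
  x = 0 ∨ x = 1 ∨ x = -1 ∨ ∃ v, x = X v

/-- A printed parameter is a good parameter. [cite: Burgisser2006, proof of Thm. 2.10] -/
theorem LeafParam.goodParam {s : ℕ} {x : MvPolynomial S ℤ} (hx : LeafParam x) : GoodParam s x := by
  rcases hx with hx | hx | hx | hx
  · exact Or.inl hx
  · exact Or.inr (Or.inl hx)
  · exact Or.inr (Or.inr (Or.inl hx))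
  · exact Or.inr (Or.inr (Or.inr (Or.inl hx)))

/-- A sign constant is a printed parameter. [cite: Burgisser2000, §1.4] -/
theorem leafParam_C_of_isSignConstant {c : ℤ} (hc : IsSignConstant c) :
    LeafParam (C c : MvPolynomial S ℤ) := by
  rcases hc with rfl | rfl | h
  · exact Or.inl (by simp)
  · exact Or.inr (Or.inl (by simp))
  · have : c = -1 := by omega
    subst this
    exact Or.inr (Or.inr (Or.inl (by simp)))

section Params

variable (P : ArithCircuit ℤ (S ⊕ Fin u))

/-- The parameters of an operand node, no empty gates: the collapse branch of `opKind`
(a reference to a gate of formal degree `0`) is dead. [cite: Burgisser2006, proof of Thm. 2.10] -/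
theorem paramIn_opKind_leaf (h1 : ∀ g ∈ P.gates, 1 ≤ g.fanIn) (g : ℕ) (dflt : MvPolynomial S ℤ)
    (hd : LeafParam dflt) (o : Option (Operand ℤ (S ⊕ Fin u)))
    (ho : ∀ op, o = some op → op.HasSignConstants) :
    (opKind P.gates g dflt o).ParamIn LeafParam := by
  rcases o with _ | ⟨x | j⟩ | c | j
  · exact hd
  · exact Or.inr (Or.inr (Or.inr ⟨x, rfl⟩))
  · exact Or.inr (Or.inl rfl)
  · exact leafParam_C_of_isSignConstant (ho _ rfl)
  · simp only [opKind]
    split_ifs with hlt h0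
    · exact absurd h0 (by have := one_le_getD_gateFormalDegrees P.gates h1 j; omega)
    · exact Or.inr (Or.inl rfl)
    · exact Or.inl rfl

/-- **All parameters of `toNCirc P` are printed parameters** when `P` has sign constants and no
empty gates. [cite: Burgisser2006, proof of Thm. 2.10] -/
theorem paramIn_kindC_leaf (h1 : ∀ g ∈ P.gates, 1 ≤ g.fanIn) (hsc : P.HasSignConstants) (i : ℕ) :
    (kindC P.gates P.output i).ParamIn LeafParam := by
  unfold kindC
  split_ifs with hu h2' h3 h4
  · trivial
  · cases hg : P.gates[(i - u) / 5]? with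
    | none => exact Or.inl rfl
    | some gt =>
      simp only
      have hmem : gt ∈ P.gates := List.mem_of_getElem? hg
      have hgs := hsc.1 gt hmem
      have hops : ∀ (r : ℕ) (op : Operand ℤ (S ⊕ Fin u)), gt.args[r]? = some op →
          op.HasSignConstants := by
        intro r op hop
        have hm : op ∈ gt.args := List.mem_of_getElem? hop
        cases gt with
        | sum args =>
          simp only [Gate.args, List.mem_map] at hm
          obtain ⟨a, ha, rfl⟩ := hm
          exact (hgs a ha).2
        | prod args => exact hgs op hm
      have hdflt : LeafParam (dfltOf gt) := by
        cases gt
        · exact Or.inl rfl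
        · exact Or.inr (Or.inl rfl)
      have hcoef : ∀ r, LeafParam (coefOf gt r) := by
        intro r
        cases gt with
        | sum args =>
          simp only [coefOf]
          cases ha : args[r]? with
          | none => exact Or.inl rfl
          | some a => exact leafParam_C_of_isSignConstant (hgs a (List.mem_of_getElem? ha)).1
        | prod args => exact Or.inr (Or.inl rfl)
      unfold gateKind
      split_ifs
      · exact P.paramIn_opKind_leaf h1 _ _ hdflt _ (hops 0)
      · exact P.paramIn_opKind_leaf h1 _ _ hdflt _ (hops 1)
      · exact hcoef 0
      · exact hcoef 1
      · cases gt <;> trivial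
  · exact P.paramIn_opKind_leaf h1 _ _ (Or.inl rfl) _ (fun op hop => by cases hop; exact hsc.2)
  · exact Or.inr (Or.inl rfl)
  · exact Or.inl rfl

end Params

/-! ### The permanent form of the Boolean sum, printed parameters -/

/-- **The permanent form of the Boolean sum of a constant-free circuit WITHOUT empty gates**:
a matrix with entries `0, ±1, X v` whose permanent is `2^K · ∑_e P(X, e)` — the statement of
`exists_permanent_boolSum` with `GoodParam` sharpened to `LeafParam`; same factor system, same
size bound `cfBound`. [cite: Burgisser2006, Thm. 2.10] -/
theorem exists_permanent_boolSum_leaf [Fintype S] (P : ArithCircuit ℤ (S ⊕ Fin u))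
    (h2 : P.IsFanInTwo) (h1 : ∀ g ∈ P.gates, 1 ≤ g.fanIn) (hsc : P.HasSignConstants) :
    ∃ (N K : ℕ) (B : Matrix (Fin N) (Fin N) (MvPolynomial S ℤ)),
      N + K ≤ cfBound P.gates.length P.formalDegree u ∧
      (∀ a b, LeafParam (B a b)) ∧ B.permanent = 2 ^ K * boolSum P.eval := by
  -- the normalized circuit and its budget
  set N₀ := P.toNCirc with hN₀
  set s := P.gates.length
  set D := (s + 1) * P.formalDegree + 1 with hDdef
  have hD : 1 ≤ D := by omega
  have hm : 0 < N₀.m := by show 0 < u + 5 * s + 2; omega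
  have hm1 : N₀.m - 1 = u + 5 * s + 1 := by show u + 5 * s + 2 - 1 = _; omega
  have hroot : N₀.fd (N₀.m - 1) ≤ D := by rw [hm1]; exact P.fd_root h2
  -- the factor system and its permanent
  obtain ⟨N, B, hN, hB, F, hF, hper⟩ := (N₀.FS D hD hm hroot).exists_permanent LeafParam
    (Or.inl rfl) (Or.inr (Or.inl rfl)) (Or.inr (Or.inr (Or.inl rfl)))
    (fun f => N₀.paramIn_kindF D hD LeafParam (Or.inr (Or.inl rfl)) (P.paramIn_kindC_leaf h1 hsc) f)
  refine ⟨N, Fintype.card (N₀.Var D), B, ?_, hB, ?_⟩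
  · -- the size bound
    have hV : Fintype.card (N₀.Var D) ≤ 2 * ((u + 5 * s + 2) * (D + 1)) + 1 + u * (D + 1) := by
      simp only [NCirc.Var, NCirc.Tok, NCirc.Aux, NCirc.Clone, Fintype.card_sum, Fintype.card_unit]
      have hm' : N₀.m = u + 5 * s + 2 := rfl
      have hu' : N₀.u = u := rfl
      have h1 : Fintype.card {p : (Fin N₀.m × Fin (D + 1)) × Fin 2 //
          N₀.CValid D p.1 ∧ p.2.val < (N₀.kind p.1.1.val).ar} ≤ (u + 5 * s + 2) * (D + 1) * 2 := by
        have := Fintype.card_subtype_le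
          (fun p : (Fin N₀.m × Fin (D + 1)) × Fin 2 => N₀.CValid D p.1 ∧ p.2.val < (N₀.kind p.1.1.val).ar)
        simp only [Fintype.card_prod, Fintype.card_fin] at this
        calc _ ≤ N₀.m * (D + 1) * 2 := this
          _ = (u + 5 * s + 2) * (D + 1) * 2 := by rw [hm']
      have h2 : Fintype.card {q : Fin N₀.u × Fin (D + 1) // q.2.val + 1 ≤ D} ≤ u * (D + 1) := by
        have := Fintype.card_subtype_le (fun q : Fin N₀.u × Fin (D + 1) => q.2.val + 1 ≤ D)
        simp only [Fintype.card_prod, Fintype.card_fin] at this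
        calc _ ≤ N₀.u * (D + 1) := this
          _ = u * (D + 1) := by rw [hu']
      omega
    have hmF : (N₀.FS D hD hm hroot).m = (u + 5 * s + 2) * (D + 1) + (1 + u) := rfl
    have hVV : Fintype.card (N₀.FS D hD hm hroot).V = Fintype.card (N₀.Var D) := rfl
    rw [hmF, hVV] at hN
    have key : N + Fintype.card (N₀.Var D) ≤ 34 * (u + 5 * s + 2) * (D + 1) + 13 := by
      nlinarith [Nat.zero_le (u * (D + 1)), Nat.zero_le ((u + 5 * s + 2) * (D + 1))]
    have hD1 : D + 1 = (s + 1) * P.formalDegree + 2 := by omega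
    calc N + Fintype.card (N₀.Var D) ≤ 34 * (u + 5 * s + 2) * (D + 1) + 13 := key
      _ = cfBound s P.formalDegree u := by unfold cfBound; rw [hD1]
  · -- the permanent
    have hVV : Fintype.card (N₀.FS D hD hm hroot).V = Fintype.card (N₀.Var D) := rfl
    have h := N₀.sum_prod_factors D hD hm hroot F hF
    rw [hper, hVV, show (∑ b : (N₀.FS D hD hm hroot).V → Bool, ∏ f : Fin (N₀.FS D hD hm hroot).m, F f b) = _
      from h]
    congr 1
    unfold boolSum
    refine Finset.sum_congr rfl fun e _ => ?_
    rw [hm1]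
    exact P.val_root h2 e

end ArithCircuit

/-! ### The printed entries -/

/-- **An entry of the printed matrices of Bürgisser's Thm. 2.10**: "`f_n = Per_{p(n)}(y_1, …,
y_{p(n)²})`, where … the `y_i` are either variables or constants taken from `{-1, -1/2, 0, 1/2, 1}`.
By homogeneity of the permanent we get `2^{p(n)} f_n = Per_{p(n)}(2y_1, …, 2y_{p(n)²})`" — so an
entry `2 y_i` is `2 X_v` or an integer in `{-2, -1, 0, 1, 2}`. Compare the tree's
`IsPerProjectionEntry q` (integer constants of `τ ≤ q`). [cite: Burgisser2006, proof of Thm. 2.10] -/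
def IsPrintedPerProjectionEntry {σ : Type} (a : MvPolynomial σ ℤ) : Prop :=
  (∃ v : σ, a = C 2 * X v) ∨ ∃ c : ℤ, a = C c ∧ |c| ≤ 2

/-- A printed entry is an admissible entry of the tree's `Burgisser2009_perProjection` as soon as
`q ≥ 2` (`τ(±1) = τ(0) = 0`, `τ(2) ≤ 1`, `τ(-2) ≤ 2`). [cite: Burgisser2006, proof of Thm. 2.10] -/
theorem IsPrintedPerProjectionEntry.isPerProjectionEntry {σ : Type} {q : ℕ} (hq : 2 ≤ q)
    {a : MvPolynomial σ ℤ} (h : IsPrintedPerProjectionEntry a) : IsPerProjectionEntry q a := by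
  rcases h with ⟨v, rfl⟩ | ⟨c, rfl, hc⟩
  · exact Or.inl ⟨v, rfl⟩
  · refine Or.inr ⟨c, rfl, ?_⟩
    have h2 := constantFreeComplexity_C_two_le (σ := σ)
    have hcases : c = 0 ∨ c = 1 ∨ c = -1 ∨ c = 2 ∨ c = -2 := by
      rcases abs_le.1 hc with ⟨h₁, h₂⟩; omega
    rcases hcases with rfl | rfl | rfl | rfl | rfl
    · rw [constantFreeComplexity_C_of_isSignConstant ArithCircuit.isSignConstant_zero]; exact Nat.zero_le _
    · rw [constantFreeComplexity_C_of_isSignConstant ArithCircuit.isSignConstant_one]; exact Nat.zero_le _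
    · rw [constantFreeComplexity_C_neg_one]; exact Nat.zero_le _
    · exact h2.trans (by omega)
    · have : (C (-2) : MvPolynomial σ ℤ) = C 2 * C (-1) := by rw [← C_mul]; norm_num
      rw [this]
      refine (constantFreeComplexity_mul_le _ _).trans ?_
      rw [constantFreeComplexity_C_neg_one]
      omega

namespace ArithCircuit

variable {S : Type}

/-- `2 ·` a printed parameter is a printed entry (`0, ±2, 2 X_v`). [cite: Burgisser2006, proof of Thm. 2.10] -/
theorem isPrintedPerProjectionEntry_two_mul {x : MvPolynomial S ℤ} (hx : LeafParam x) :
    IsPrintedPerProjectionEntry (2 * x) := by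
  rcases hx with rfl | rfl | rfl | ⟨v, rfl⟩
  · exact Or.inr ⟨0, by simp, by simp⟩
  · exact Or.inr ⟨2, by simp [map_ofNat], by simp⟩
  · exact Or.inr ⟨-2, by simp [map_ofNat, map_neg], by simp⟩
  · exact Or.inl ⟨v, by simp [map_ofNat]⟩

/-- The padding constants `0`, `1`, `2` are printed entries. [cite: Burgisser2006, proof of Thm. 2.10] -/
theorem isPrintedPerProjectionEntry_ite (c : Prop) [Decidable c] (a : ℤ) (ha : a = 1 ∨ a = 2) :
    IsPrintedPerProjectionEntry ((if c then C a else 0 : MvPolynomial S ℤ)) := by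
  split_ifs
  · refine Or.inr ⟨a, rfl, ?_⟩
    rcases ha with rfl | rfl <;> simp
  · exact Or.inr ⟨0, by simp, by simp⟩

/-- **Scaling and padding, printed entries**: from `per B = 2^K q` with printed parameters to a
`p × p` matrix with printed entries and `per = 2^p q`, for any `p ≥ N + K`: scale `B` by `2`,
pad with `K` ones and `p - N - K` twos on the diagonal. [cite: Burgisser2006, proof of Thm. 2.10] -/
theorem exists_printedPerProjection_matrix (q : MvPolynomial S ℤ) {N K : ℕ}
    (B : Matrix (Fin N) (Fin N) (MvPolynomial S ℤ)) (hB : ∀ a b, LeafParam (B a b))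
    (hper : B.permanent = 2 ^ K * q) (p : ℕ) (hp : N + K ≤ p) :
    ∃ B' : Matrix (Fin p) (Fin p) (MvPolynomial S ℤ),
      (∀ i j, IsPrintedPerProjectionEntry (B' i j)) ∧ B'.permanent = C ((2 : ℤ) ^ p) * q := by
  set t := p - N - K with ht
  -- the padded matrix on `(Fin N ⊕ Fin K) ⊕ Fin t`
  let M : Matrix ((Fin N ⊕ Fin K) ⊕ Fin t) ((Fin N ⊕ Fin K) ⊕ Fin t) (MvPolynomial S ℤ) :=
    fromBlocks (fromBlocks ((2 : MvPolynomial S ℤ) • B) 0 0 1) 0 0 ((2 : MvPolynomial S ℤ) • 1)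
  have hMper : M.permanent = 2 ^ p * q := by
    simp only [M]
    rw [permanent_fromBlocks_zero₁₂, permanent_fromBlocks_zero₁₂, permanent_smul, permanent_smul,
      permanent_one, permanent_one, hper, Fintype.card_fin, Fintype.card_fin, mul_one, mul_one]
    have : p = N + K + t := by omega
    rw [this]; ring
  -- reindex to `Fin p`
  let e : Fin p ≃ (Fin N ⊕ Fin K) ⊕ Fin t :=
    (finCongr (by omega : p = N + K + t)).trans
      (finSumFinEquiv.symm.trans (Equiv.sumCongr finSumFinEquiv.symm (Equiv.refl _)))
  refine ⟨M.submatrix e e, fun i j => ?_, ?_⟩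
  · -- entries
    simp only [submatrix_apply]
    rcases e i with (a | a) | a <;> rcases e j with (b | b) | b
    · simp only [M, fromBlocks_apply₁₁, Matrix.smul_apply, smul_eq_mul]
      exact isPrintedPerProjectionEntry_two_mul (hB a b)
    · simp only [M, fromBlocks_apply₁₁, fromBlocks_apply₁₂, Matrix.zero_apply]
      exact Or.inr ⟨0, by simp, by simp⟩
    · simp only [M, fromBlocks_apply₁₂, Matrix.zero_apply]
      exact Or.inr ⟨0, by simp, by simp⟩
    · simp only [M, fromBlocks_apply₁₁, fromBlocks_apply₂₁, Matrix.zero_apply]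
      exact Or.inr ⟨0, by simp, by simp⟩
    · simp only [M, fromBlocks_apply₁₁, fromBlocks_apply₂₂, Matrix.one_apply]
      have := isPrintedPerProjectionEntry_ite (S := S) (a = b) 1 (Or.inl rfl)
      simpa using this
    · simp only [M, fromBlocks_apply₁₂, Matrix.zero_apply]
      exact Or.inr ⟨0, by simp, by simp⟩
    · simp only [M, fromBlocks_apply₂₁, Matrix.zero_apply]
      exact Or.inr ⟨0, by simp, by simp⟩
    · simp only [M, fromBlocks_apply₂₁, Matrix.zero_apply]
      exact Or.inr ⟨0, by simp, by simp⟩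
    · simp only [M, fromBlocks_apply₂₂, Matrix.smul_apply, Matrix.one_apply, smul_eq_mul, mul_ite,
        mul_one, mul_zero]
      have := isPrintedPerProjectionEntry_ite (S := S) (a = b) 2 (Or.inr rfl)
      simpa [map_ofNat] using this
  · rw [permanent_submatrix_equiv, hMper, C_pow]
    simp [map_ofNat]

end ArithCircuit

/-! ### The theorem -/

/-- **Bürgisser 2009, Thm. 2.10, algebraic content, for the PRINTED `VNP⁰` and with the PRINTED
entries** (ECCC TR06-113, proof of Thm. 2.10, p. 8): "any family `(f_n)` in `VNP⁰` can be
expressed as a projection `f_n = Per_{p(n)}(y_1, …, y_{p(n)²})`, where `p(n)` is polynomially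
bounded in `n` and the `y_i` are either variables or constants taken from `{-1, -1/2, 0, 1/2, 1}`.
By homogeneity of the permanent we get `2^{p(n)} f_n = Per_{p(n)}(2y_1, …, 2y_{p(n)²})`."
For every family in the printed class `VNP⁰` (`IsExactVNP0Family`: fan-in EXACTLY two, Def.
2.7–2.8) there is a p-bounded `p` and, for every `n`, a `p(n) × p(n)` matrix over `ℤ[X]` with
entries in `{2 X_v} ∪ {-2, -1, 0, 1, 2}` (`IsPrintedPerProjectionEntry`) and permanent
`2^{p(n)} f_n`. The tree's discharged `Burgisser2009_perProjection` states this for the LARGER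
class `IsVNP0Family` with the WEAKER entry set "`2 X_v` or a constant of `τ ≤ p(n)`" (forced there
by the empty-gate constants, registry B41); here no gate has formal degree `0`
(`ArithCircuit.forall_one_le_gateFormalDegrees`), so the collapse of `VP0Normal` is vacuous and
Valiant's construction (`TokenCircuits` / `FactorSystems` / `TokenExpansion`, unchanged) only
ever writes `0, ±1, X_v`. [cite: Burgisser2006, proof of Thm. 2.10; Def. 2.7–2.8] -/
theorem Burgisser2009_perProjection_exact :
    ∀ (σ : ℕ → Type) [∀ n, Fintype (σ n)] (f : ∀ n, MvPolynomial (σ n) ℤ), IsExactVNP0Family f →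
      ∃ p : ℕ → ℕ, IsPBounded p ∧ ∀ n,
        ∃ B : Matrix (Fin (p n)) (Fin (p n)) (MvPolynomial (σ n) ℤ),
          (∀ i j, IsPrintedPerProjectionEntry (B i j)) ∧ B.permanent = C ((2 : ℤ) ^ p n) * f n := by
  intro σ _ f hf
  obtain ⟨u, g, ⟨hcard, Cn, hC, hsize, hfdeg⟩, hfg⟩ := hf
  have hu : IsPBounded u := hcard.mono fun n => by simp
  refine ⟨fun n => ArithCircuit.cfBound (Cn n).size (Cn n).formalDegree (u n),
    isPBounded_cfBound hsize hfdeg hu, fun n => ?_⟩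
  have h2 : (Cn n).IsFanInTwo := fun g hg => ((hC n).1 g hg).le
  have h1 : ∀ g ∈ (Cn n).gates, 1 ≤ g.fanIn := fun g hg => by rw [(hC n).1 g hg]; omega
  obtain ⟨N, K, B, hNK, hB, hper⟩ :=
    ArithCircuit.exists_permanent_boolSum_leaf (Cn n) h2 h1 (hC n).2.1
  have heval : (Cn n).eval = g n := (hC n).2.2
  rw [heval, ← hfg n] at hper
  exact ArithCircuit.exists_printedPerProjection_matrix (f n) B hB hper _ hNK

/-- The printed form implies the tree's form for printed-`VNP⁰` families (entries of `τ ≤ p(n)`,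
after raising `p` to `≥ 2`). [cite: Burgisser2006, proof of Thm. 2.10] -/
theorem Burgisser2009_perProjection_of_exact (σ : ℕ → Type) [∀ n, Fintype (σ n)]
    (f : ∀ n, MvPolynomial (σ n) ℤ) (hf : IsExactVNP0Family f) :
    ∃ p : ℕ → ℕ, IsPBounded p ∧ ∀ n,
      ∃ B : Matrix (Fin (p n)) (Fin (p n)) (MvPolynomial (σ n) ℤ),
        (∀ i j, IsPerProjectionEntry (p n) (B i j)) ∧ B.permanent = C ((2 : ℤ) ^ p n) * f n :=
  Burgisser2009_perProjection_holds σ f hf.isVNP0Family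

end Literature.Computability.AlgebraicComplexity
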